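import Mathlib
import Summits.ResolutionOfSingularities.ResolutionOfSingularities.Theorems.RadicialJungCleanModelsCleanProp44PointChainNoBad
import Summits.ResolutionOfSingularities.ResolutionOfSingularities.Theorems.RadicialJungCleanModelsL7bGlobalCleanPermSeq
import Summits.ResolutionOfSingularities.ResolutionOfSingularities.Theorems.FrobeniusLadderFInjectiveMacaulayficationProp44ReachTidy
import HarnessLib

/-!
# Route `RadicialJung`, crux `CleanModels` (stmt-ResolutionOfSingularities-15917), line `Sketch` rev 35, stub 6 `stub_cleanProp44` (X44c):
# L7b-GLOBAL WITH «NO BAD POINT» — insert along an intersecting curve and blow it up WITHOUT LEAVING the no-bad world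

Seat decomp-res-hand-2 g17, sequel of ✓ `…CleanProp44PointChainNoBad.lean` (`IsPointChainAlong.isCleanPermissibleSeq_noBad`).  The landed L7b-global
(✓ `exists_isCleanPermissibleSeq_forall_cleanPermissibleAt_of_ncard_le`, ✓ `exists_isCleanPermissibleSeq_blowup_curve`, hand-2 g10) makes any regular curve
`C₀ = cl{η}` of the `μ`-stratum clean-permissible by finitely many insertion chains and then blows up its strict transform — with the stage after the
insertions OPAQUE.  For the Phase II residual (R1ᵐⁱⁿ) (✓ `cleanProp44_of_phaseTwoMin_of_curveMinNoGamma`) one needs to know that this move stays among the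
stages WITHOUT BAD POINTS (curves of `Σ` regular and pairwise transverse), so that its effect on the printed potential `Λ` is the only open question.
This file re-runs the two inductions with the riders `dim ≤ 3`, `codim V(J) ≥ 2`, «no bad point» (chains: ✓ `…_noBad`; the final curve blow-up:
✓ `CP2008Prop44.curveStep_noBad`, the strict transform `C = cl{η′}` being a curve of `Σ(J′)`).

* `exists_isCleanPermissibleSeq_forall_cleanPermissibleAt_of_ncard_le_noBad` — L7b-global (induction on the number of bad points) with the riders.
* `exists_isCleanPermissibleSeq_blowup_curve_noBad` — the curve-centre step with the riders: no bad point before AND after the blowing up of the strict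
  transform.

Honest framing: OURS (bookkeeping); nothing here proves X44c, any case of `CleanModels`, or resolution of singularities in characteristic `p`.
[cite: CossartPiltant2008, Prop. 4.4 (proof, p. 10); Prop. 4.2 (a); Lemma 4.3] [cite: CossartJannsenSaito2020, proof of Thm. 6.28, Step 5]
[cite: Piltant2013, §2 Axiom 4]
-/

noncomputable section

set_option linter.dupNamespace false -- mandated namespace of this single-conjunct summit

open CategoryTheory AlgebraicGeometry TopologicalSpace IsLocalRing Opposite
open Literature.AlgebraicGeometry.Resolution Literature.AlgebraicGeometry.Motives
open Scheme.IdealSheafData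
open Summit.ResolutionOfSingularities.ResolutionOfSingularities.Theorems.CP2008Prop44

namespace Summit.ResolutionOfSingularities.ResolutionOfSingularities.Theorems.RadicialJung.CleanModels

set_option maxHeartbeats 1600000 in
-- the induction of L7b-global with three riders
/-- **L7b-global inside a clean-permissible sequence for `(J, μ)`, keeping «no bad point»** (✓ `exists_isCleanPermissibleSeq_forall_cleanPermissibleAt_of_ncard_le`
with the riders `dim ≤ 3`, `codim ≥ 2`, no bad point). [cite: CossartPiltant2008, Prop. 4.4 (proof, p. 10)] [cite: Piltant2013, §2 Axiom 4] -/
theorem exists_isCleanPermissibleSeq_forall_cleanPermissibleAt_of_ncard_le_noBad (p : ℕ) [hp : Fact p.Prime] (N : ℕ) :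
    ∀ {X X₁ : Scheme.{0}} [IsIntegral X] [IsIntegral X₁] [IsNoetherian X₁] {π : X₁ ⟶ X} [IsDominant π] {J : X.IdealSheafData} {μ : ℕ}
      {J₁ : X₁.IdealSheafData} {G : X.functionField} [CharP X.functionField p] (_ : IsCleanPermissibleSeq p π J μ J₁ G)
      (_ : ∀ x : X, CleanRegAt p (algebraMap (X.presheaf.stalk x) X.functionField) G)
      (_ : Scheme.IsRegular X₁) (_ : Scheme.IsQuasiExcellent X₁) (_ : ∀ x : X₁, idealOrder J₁ x ≤ μ)
      (_ : topologicalKrullDim X₁ ≤ 3) (_ : 1 ≤ μ) (_ : ∀ z ∈ J₁.support, 1 < Order.coheight z)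
      (_ : (∀ y : X₁, ¬ ∃ D ∈ {D : Closeds X₁ | ∃ ζ ∈ maxPoints {z : X₁ | (μ : ℕ∞) ≤ idealOrder J₁ z},
            ¬ IsClosed ({ζ} : Set X₁) ∧ D = ⟨closure {ζ}, isClosed_closure⟩},
          y ∈ (vanishingIdeal D).subschemeι '' (Scheme.regularLocus (vanishingIdeal D).subscheme)ᶜ ∨
          (y ∈ (D : Set X₁) ∧ ∃ D' ∈ {D : Closeds X₁ | ∃ ζ ∈ maxPoints {z : X₁ | (μ : ℕ∞) ≤ idealOrder J₁ z},
              ¬ IsClosed ({ζ} : Set X₁) ∧ D = ⟨closure {ζ}, isClosed_closure⟩}, D' ≠ D ∧ y ∈ (D' : Set X₁) ∧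
            stalkIdeal (vanishingIdeal D) y ⊔ stalkIdeal (vanishingIdeal D') y ≠ maximalIdeal (X₁.presheaf.stalk y)))) {C₀ : Closeds X₁}
      (_ : ∀ y ∈ (C₀ : Set X₁), ∃ c : Fin 2 → X₁.presheaf.stalk y, IsRsopPart c ∧ Ideal.span (Set.range c) = stalkIdeal (vanishingIdeal C₀) y)
      {η : X₁} (_ : (C₀ : Set X₁) = closure {η}) (_ : ∀ y ∈ (C₀ : Set X₁), y ≠ η → IsClosed ({y} : Set X₁))
      (_ : ∀ y ∈ (C₀ : Set X₁), y ≠ η → ringKrullDim (X₁.presheaf.stalk y) = 3) (_ : ∀ y ∈ (C₀ : Set X₁), idealOrder J₁ y = μ)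
      (G₁ : X₁.functionField) (_ : G₁ = RatFn.functionFieldMap π G)
      (_ : {y : X₁ | y ∈ (C₀ : Set X₁) ∧ ¬ CleanPermissibleAt p (RatFn.toFunctionField y) G₁ (stalkIdeal (vanishingIdeal C₀) y)}.Finite)
      (_ : {y : X₁ | y ∈ (C₀ : Set X₁) ∧ ¬ CleanPermissibleAt p (RatFn.toFunctionField y) G₁ (stalkIdeal (vanishingIdeal C₀) y)}.ncard ≤ N),
    ∃ (X' : Scheme.{0}) (_ : IsIntegral X') (_ : IsNoetherian X') (σ : X' ⟶ X₁) (_ : IsDominant σ) (C : Closeds X') (η' : X')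
      (J' : X'.IdealSheafData),
      IsCleanPermissibleSeq p (σ ≫ π) J μ J' G ∧ IsProper σ ∧ Scheme.IsRegular X' ∧ Scheme.IsQuasiExcellent X' ∧
      (∀ y ∈ (C : Set X'), ∃ c : Fin 2 → X'.presheaf.stalk y, IsRsopPart c ∧ Ideal.span (Set.range c) = stalkIdeal (vanishingIdeal C) y) ∧
      (C : Set X') = closure {η'} ∧ σ η' = η ∧ (∀ x' : X', idealOrder J' x' ≤ μ) ∧ (∀ y ∈ (C : Set X'), idealOrder J' y = μ) ∧
      topologicalKrullDim X' ≤ 3 ∧ (∀ z ∈ J'.support, 1 < Order.coheight z) ∧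
      (∀ y : X', ¬ ∃ D ∈ {D : Closeds X' | ∃ ζ ∈ maxPoints {z : X' | (μ : ℕ∞) ≤ idealOrder J' z},
          ¬ IsClosed ({ζ} : Set X') ∧ D = ⟨closure {ζ}, isClosed_closure⟩},
        y ∈ (vanishingIdeal D).subschemeι '' (Scheme.regularLocus (vanishingIdeal D).subscheme)ᶜ ∨
        (y ∈ (D : Set X') ∧ ∃ D' ∈ {D : Closeds X' | ∃ ζ ∈ maxPoints {z : X' | (μ : ℕ∞) ≤ idealOrder J' z},
            ¬ IsClosed ({ζ} : Set X') ∧ D = ⟨closure {ζ}, isClosed_closure⟩}, D' ≠ D ∧ y ∈ (D' : Set X') ∧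
          stalkIdeal (vanishingIdeal D) y ⊔ stalkIdeal (vanishingIdeal D') y ≠ maximalIdeal (X'.presheaf.stalk y))) ∧
      ∀ y ∈ (C : Set X'), CleanPermissibleAt p (RatFn.toFunctionField y) (RatFn.functionFieldMap σ G₁) (stalkIdeal (vanishingIdeal C) y) := by
  induction N with
  | zero =>
    intro X X₁ _ _ _ π _ J μ J₁ G _ hπ hG hX₁ hE₁ hJ₁le hX3₁ hμ hcodim₁ hRT₁ C₀ hC₀reg η hη hcl hdim3 hC₀μ G₁ hG₁ hfin hN
    have hgood : ∀ y ∈ (C₀ : Set X₁), CleanPermissibleAt p (RatFn.toFunctionField y) G₁ (stalkIdeal (vanishingIdeal C₀) y) := by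
      intro y hy
      by_contra hbad
      have h0 := (Set.ncard_eq_zero hfin).mp (Nat.le_zero.mp hN)
      have hmem : y ∈ {y : X₁ | y ∈ (C₀ : Set X₁) ∧
          ¬ CleanPermissibleAt p (RatFn.toFunctionField y) G₁ (stalkIdeal (vanishingIdeal C₀) y)} := ⟨hy, hbad⟩
      rw [h0] at hmem
      exact hmem
    refine ⟨X₁, inferInstance, inferInstance, 𝟙 X₁, inferInstance, C₀, η, J₁, by simpa using hπ, inferInstance, hX₁, hE₁, hC₀reg, hη, rfl,
      hJ₁le, hC₀μ, hX3₁, hcodim₁, hRT₁, ?_⟩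
    intro y hy
    rw [RatFn.functionFieldMap_id, RingHom.id_apply]
    exact hgood y hy
  | succ N ih =>
    intro X X₁ _ _ _ π _ J μ J₁ G _ hπ hG hX₁ hE₁ hJ₁le hX3₁ hμ hcodim₁ hRT₁ C₀ hC₀reg η hη hcl hdim3 hC₀μ G₁ hG₁ hfin hN
    classical
    haveI : CharP X₁.functionField p := charP_of_injective_ringHom (RatFn.functionFieldMap π).injective p
    have hclean : ∀ x : X₁, CleanRegAt p (RatFn.toFunctionField x) G₁ := by
      intro x; rw [hG₁]; exact hπ.cleanRegAt hp.out inferInstance hG x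
    have hηgood : CleanPermissibleAt p (RatFn.toFunctionField η) G₁ (stalkIdeal (vanishingIdeal C₀) η) :=
      cleanPermissibleAt_genericPoint_of_cleanRegAt p hη G₁ (hclean η)
    by_cases hle : {y : X₁ | y ∈ (C₀ : Set X₁) ∧
        ¬ CleanPermissibleAt p (RatFn.toFunctionField y) G₁ (stalkIdeal (vanishingIdeal C₀) y)}.ncard ≤ N
    · exact ih hπ hG hX₁ hE₁ hJ₁le hX3₁ hμ hcodim₁ hRT₁ hC₀reg hη hcl hdim3 hC₀μ G₁ hG₁ hfin hle
    have hne : {y : X₁ | y ∈ (C₀ : Set X₁) ∧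
        ¬ CleanPermissibleAt p (RatFn.toFunctionField y) G₁ (stalkIdeal (vanishingIdeal C₀) y)}.Nonempty := by
      rw [Set.nonempty_iff_ne_empty]
      intro h0
      apply hle
      rw [h0, Set.ncard_empty]; exact Nat.zero_le _
    obtain ⟨x₀, hx₀C, hx₀bad⟩ := hne
    have hx₀η : x₀ ≠ η := by rintro rfl; exact hx₀bad hηgood
    -- the descent step: one chain at `x₀`
    obtain ⟨X₂, hX₂i, hX₂n, σ₁, hσ₁d, C₁, x₁, n₁, hchain, hσx, hx₁cl, hx₁good, hfin₁, hlt⟩ :=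
      exists_pointChain_good_ncard_bad_lt hX₁ hE₁ p hC₀reg hη hcl hdim3 G₁ hfin hx₀C hx₀η hx₀bad (hclean x₀)
    subst hσx
    have hx₀cl : IsClosed ({σ₁ x₁} : Set X₁) := hcl _ hx₀C hx₀η
    have hdim₀ : ringKrullDim (X₁.presheaf.stalk (σ₁ x₁)) = 3 := hdim3 _ hx₀C hx₀η
    have h0 : σ₁ x₁ ∈ closure ((C₀ : Set X₁) \ {σ₁ x₁}) := by
      have hsub : ({η} : Set X₁) ⊆ (C₀ : Set X₁) \ {σ₁ x₁} := by
        rintro z hz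
        rw [Set.mem_singleton_iff] at hz
        subst hz
        exact ⟨by rw [hη]; exact subset_closure rfl, fun heq => hx₀η (Set.mem_singleton_iff.mp heq).symm⟩
      have h1 := closure_mono hsub
      rw [← hη] at h1
      exact h1 hx₀C
    obtain ⟨hX₂, hC₁reg, -, -⟩ := data_along_pointChain hchain hX₁ hC₀reg hx₀C hdim₀
    have hE₂ : Scheme.IsQuasiExcellent X₂ := hchain.isQuasiExcellent hE₁
    obtain ⟨η₁, hη₁C, hση₁, hη₁, hcl₁, hdim3₁, hoff⟩ := hchain.curve_data hX₁ hC₀reg hη hcl hdim3 hx₀C hx₀η hx₁cl p G₁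
    -- the chain is a legal extension of the clean-permissible sequence
    obtain ⟨_, _, J₂, hseq₂, hJ₂le, hC₁μ, -, hcodim₂, hX3₂, hRT₂⟩ :=
      hchain.isCleanPermissibleSeq_noBad hp.out hπ hG hX₁ hE₁ hX3₁ hμ hJ₁le hcodim₁ hRT₁ hC₀reg hC₀μ hx₀C hdim₀ hx₀cl h0
    haveI : IsProper σ₁ := hchain.isProper
    haveI : CompactSpace X₂ := QuasiCompact.compactSpace_of_compactSpace σ₁
    haveI : IsNoetherian X₂ := {}
    have hG₂ : RatFn.functionFieldMap σ₁ G₁ = RatFn.functionFieldMap (σ₁ ≫ π) G := by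
      rw [hG₁, RatFn.functionFieldMap_comp π σ₁, RingHom.comp_apply]
    have hN₁ : {y : X₂ | y ∈ (C₁ : Set X₂) ∧
        ¬ CleanPermissibleAt p (RatFn.toFunctionField y) (RatFn.functionFieldMap σ₁ G₁) (stalkIdeal (vanishingIdeal C₁) y)}.ncard ≤ N := by
      omega
    obtain ⟨X₃, hX₃i, hX₃n, σ₂, hσ₂d, C₂, η₂, J₃, hseq₃, hprop₃, hX₃, hE₃, hC₂reg, hη₂, hση₂, hJ₃le, hC₂μ, hX3₃, hcodim₃, hRT₃, hall⟩ :=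
      ih hseq₂ hG hX₂ hE₂ hJ₂le hX3₂ hμ hcodim₂ hRT₂ hC₁reg hη₁ hcl₁ hdim3₁ hC₁μ (RatFn.functionFieldMap σ₁ G₁) hG₂ hfin₁ hN₁
    haveI := hprop₃
    refine ⟨X₃, hX₃i, hX₃n, σ₂ ≫ σ₁, inferInstance, C₂, η₂, J₃, by simpa only [Category.assoc] using hseq₃, inferInstance, hX₃, hE₃, hC₂reg,
      hη₂, ?_, hJ₃le, hC₂μ, hX3₃, hcodim₃, hRT₃, ?_⟩
    · rw [Scheme.Hom.comp_apply, hση₂, hση₁]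
    · intro y hy
      rw [RatFn.functionFieldMap_comp σ₁ σ₂, RingHom.comp_apply]
      exact hall y hy

set_option maxHeartbeats 1600000 in
-- long binder lists
/-- **The curve-centre step of [CoP1] Prop. 4.4, clean version, keeping «no bad point»** (✓ `exists_isCleanPermissibleSeq_blowup_curve` with the riders;
`η` not closed): no bad point at the stage after the insertions AND after the blowing up of the strict transform (✓ `CP2008Prop44.curveStep_noBad`).
[cite: CossartPiltant2008, Prop. 4.4 and Prop. 4.2 (a), Lemma 4.3 (2) (4)] [cite: Piltant2013, §2 Axiom 4] -/
theorem exists_isCleanPermissibleSeq_blowup_curve_noBad (p : ℕ) [hp : Fact p.Prime] {X X₁ : Scheme.{0}} [IsIntegral X] [IsIntegral X₁]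
    [IsNoetherian X₁] {π : X₁ ⟶ X} [IsDominant π] {J : X.IdealSheafData} {μ : ℕ} {J₁ : X₁.IdealSheafData} {G : X.functionField}
    [CharP X.functionField p] (hπ : IsCleanPermissibleSeq p π J μ J₁ G)
    (hG : ∀ x : X, CleanRegAt p (algebraMap (X.presheaf.stalk x) X.functionField) G) (hX₁ : Scheme.IsRegular X₁)
    (hE₁ : Scheme.IsQuasiExcellent X₁) (hX3 : ∀ x : X₁, ringKrullDim (X₁.presheaf.stalk x) ≤ 3) (hJ₁le : ∀ x : X₁, idealOrder J₁ x ≤ μ)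
    (hX3₁ : topologicalKrullDim X₁ ≤ 3) (hμ : 1 ≤ μ) (hcodim₁ : ∀ z ∈ J₁.support, 1 < Order.coheight z)
    (hRT₁ : (∀ y : X₁, ¬ ∃ D ∈ {D : Closeds X₁ | ∃ ζ ∈ maxPoints {z : X₁ | (μ : ℕ∞) ≤ idealOrder J₁ z},
          ¬ IsClosed ({ζ} : Set X₁) ∧ D = ⟨closure {ζ}, isClosed_closure⟩},
        y ∈ (vanishingIdeal D).subschemeι '' (Scheme.regularLocus (vanishingIdeal D).subscheme)ᶜ ∨
        (y ∈ (D : Set X₁) ∧ ∃ D' ∈ {D : Closeds X₁ | ∃ ζ ∈ maxPoints {z : X₁ | (μ : ℕ∞) ≤ idealOrder J₁ z},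
            ¬ IsClosed ({ζ} : Set X₁) ∧ D = ⟨closure {ζ}, isClosed_closure⟩}, D' ≠ D ∧ y ∈ (D' : Set X₁) ∧
          stalkIdeal (vanishingIdeal D) y ⊔ stalkIdeal (vanishingIdeal D') y ≠ maximalIdeal (X₁.presheaf.stalk y))))
    {C₀ : Closeds X₁}
    (hC₀reg : ∀ y ∈ (C₀ : Set X₁), ∃ c : Fin 2 → X₁.presheaf.stalk y, IsRsopPart c ∧ Ideal.span (Set.range c) = stalkIdeal (vanishingIdeal C₀) y)
    {η : X₁} (hη : (C₀ : Set X₁) = closure {η}) (hηcl : ¬ IsClosed ({η} : Set X₁)) (hC₀μ : ∀ y ∈ (C₀ : Set X₁), idealOrder J₁ y = μ) :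
    ∃ (X' : Scheme.{0}) (_ : IsIntegral X') (_ : IsNoetherian X') (σ : X' ⟶ X₁) (_ : IsDominant σ) (C : Closeds X') (η' : X')
      (J' : X'.IdealSheafData) (X'' : Scheme.{0}) (_ : IsIntegral X'') (_ : IsNoetherian X'') (τ : X'' ⟶ X') (_ : IsDominant τ),
      (C : Set X') = closure {η'} ∧ σ η' = η ∧
      (∀ y ∈ (C : Set X'), ∃ c : Fin 2 → X'.presheaf.stalk y, IsRsopPart c ∧ Ideal.span (Set.range c) = stalkIdeal (vanishingIdeal C) y) ∧
      (∀ y ∈ (C : Set X'), idealOrder J' y = μ) ∧ (∀ x' : X', idealOrder J' x' ≤ μ) ∧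
      IsCleanPermissibleSeq p (σ ≫ π) J μ J' G ∧ IsBlowup τ (vanishingIdeal C) ∧
      IsCleanPermissibleSeq p (τ ≫ σ ≫ π) J μ (controlledTransform τ (vanishingIdeal C) J' μ) G ∧
      (∀ x'' : X'', idealOrder (controlledTransform τ (vanishingIdeal C) J' μ) x'' ≤ μ) ∧
      (∀ y : X', ¬ ∃ D ∈ {D : Closeds X' | ∃ ζ ∈ maxPoints {z : X' | (μ : ℕ∞) ≤ idealOrder J' z},
          ¬ IsClosed ({ζ} : Set X') ∧ D = ⟨closure {ζ}, isClosed_closure⟩},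
        y ∈ (vanishingIdeal D).subschemeι '' (Scheme.regularLocus (vanishingIdeal D).subscheme)ᶜ ∨
        (y ∈ (D : Set X') ∧ ∃ D' ∈ {D : Closeds X' | ∃ ζ ∈ maxPoints {z : X' | (μ : ℕ∞) ≤ idealOrder J' z},
            ¬ IsClosed ({ζ} : Set X') ∧ D = ⟨closure {ζ}, isClosed_closure⟩}, D' ≠ D ∧ y ∈ (D' : Set X') ∧
          stalkIdeal (vanishingIdeal D) y ⊔ stalkIdeal (vanishingIdeal D') y ≠ maximalIdeal (X'.presheaf.stalk y))) ∧
      (∀ y : X'', ¬ ∃ D ∈ {D : Closeds X'' | ∃ ζ ∈ maxPoints {z : X'' | (μ : ℕ∞) ≤ idealOrder (controlledTransform τ (vanishingIdeal C) J' μ) z},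
          ¬ IsClosed ({ζ} : Set X'') ∧ D = ⟨closure {ζ}, isClosed_closure⟩},
        y ∈ (vanishingIdeal D).subschemeι '' (Scheme.regularLocus (vanishingIdeal D).subscheme)ᶜ ∨
        (y ∈ (D : Set X'') ∧ ∃ D' ∈ {D : Closeds X'' | ∃ ζ ∈ maxPoints {z : X'' | (μ : ℕ∞) ≤ idealOrder (controlledTransform τ (vanishingIdeal C) J' μ) z},
            ¬ IsClosed ({ζ} : Set X'') ∧ D = ⟨closure {ζ}, isClosed_closure⟩}, D' ≠ D ∧ y ∈ (D' : Set X'') ∧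
          stalkIdeal (vanishingIdeal D) y ⊔ stalkIdeal (vanishingIdeal D') y ≠ maximalIdeal (X''.presheaf.stalk y))) := by
  haveI : CharP X₁.functionField p := charP_of_injective_ringHom (RatFn.functionFieldMap π).injective p
  obtain ⟨hdimη, hcl, hdim3⟩ := curve_dimension_data hX3 hC₀reg hη
  have hclean : ∀ x : X₁, CleanRegAt p (RatFn.toFunctionField x) (RatFn.functionFieldMap π G) :=
    fun x => hπ.cleanRegAt hp.out inferInstance hG x
  have hfin := finite_setOf_not_cleanPermissibleAt_of_cleanRegAt_genericPoint hX₁ hE₁ p hC₀reg hη hdimη hcl _ (hclean η)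
  obtain ⟨X', hX'i, hX'n, σ, hσd, C, η', J', hseq, hprop, hX', hE', hCreg, hη', hση', hJ'le, hCμ, hX3', hcodim', hRT', hall⟩ :=
    exists_isCleanPermissibleSeq_forall_cleanPermissibleAt_of_ncard_le_noBad p _ hπ hG hX₁ hE₁ hJ₁le hX3₁ hμ hcodim₁ hRT₁ hC₀reg hη hcl hdim3 hC₀μ
      (RatFn.functionFieldMap π G) rfl hfin le_rfl
  haveI := hX'i
  haveI := hX'n
  haveI := hσd
  -- the centre `C`: nonzero, integral, regular
  have hη'C : η' ∈ (C : Set X') := by rw [hη']; exact subset_closure rfl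
  have hYbot : vanishingIdeal C ≠ ⊥ := by
    intro hbot
    obtain ⟨c, hc, hspan⟩ := hCreg η' hη'C
    haveI := hc.1
    have hc0 : c 0 ∈ stalkIdeal (vanishingIdeal C) η' := hspan ▸ Ideal.subset_span ⟨0, rfl⟩
    rw [hbot, stalkIdeal_bot, Ideal.mem_bot] at hc0
    exact hc.ne_zero 0 hc0
  have hint : IsIntegral (vanishingIdeal C).subscheme :=
    ComponentGluing.isIntegral_subscheme_vanishingIdeal C (by rw [hη']; exact isIrreducible_singleton.closure)
  have hreg : Scheme.IsRegular (vanishingIdeal C).subscheme :=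
    isRegular_subscheme_vanishingIdeal_of_forall_isRsopPart fun x hx => by
      obtain ⟨c, hc, h⟩ := hCreg x hx
      exact ⟨2, c, hc, h⟩
  set τ := blowup.π (vanishingIdeal C) with hτdef
  have hτ : IsBlowup τ (vanishingIdeal C) := blowup.isBlowup _
  haveI : IsIntegral (blowup (vanishingIdeal C)) := hτ.isIntegral hYbot
  haveI : IsDominant τ := isDominant_of_isBlowup_of_ne_bot hτ hYbot
  haveI : IsProper τ := hτ.isProper
  haveI : CompactSpace (blowup (vanishingIdeal C)) := QuasiCompact.compactSpace_of_compactSpace τ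
  haveI : IsLocallyNoetherian (blowup (vanishingIdeal C)) := LocallyOfFiniteType.isLocallyNoetherian τ
  haveI : IsNoetherian (blowup (vanishingIdeal C)) := {}
  have hperm : ∀ y ∈ (C : Set X'), CleanPermissibleAt p (algebraMap (X'.presheaf.stalk y) X'.functionField)
      (RatFn.functionFieldMap (σ ≫ π) G) (stalkIdeal (vanishingIdeal C) y) := by
    intro y hy
    rw [RatFn.functionFieldMap_comp π σ, RingHom.comp_apply]
    exact hall y hy
  have hcons : IsCleanPermissibleSeq p (τ ≫ σ ≫ π) J μ (controlledTransform τ (vanishingIdeal C) J' μ) G :=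
    IsCleanPermissibleSeq.cons τ (σ ≫ π) J μ J' G C hseq hint hreg hCμ hτ hperm
  have hle'' : ∀ x'', idealOrder (controlledTransform τ (vanishingIdeal C) J' μ) x'' ≤ μ :=
    fun x'' => hτ.idealOrder_controlledTransform_le_of_forall hX' hreg hCμ hJ'le x''
  -- no bad point after the blowing up of the strict transform: `C = cl{η'}` is a curve of `Σ(J')`, ✓ `curveStep_noBad`
  have hcoh3' : ∀ z : X', Order.coheight z ≤ 3 := (topologicalKrullDim_le_iff_forall_coheight_le X' 3).mp hX3'
  have hη'cl : ¬ IsClosed ({η'} : Set X') := by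
    intro h
    haveI := hprop
    have h2 := σ.isClosedMap _ h
    rw [Set.image_singleton, hση'] at h2
    exact hηcl h2
  have hsupp' : η' ∈ J'.support := by
    rw [← one_le_idealOrder_iff, hCμ η' hη'C]
    exact_mod_cast hμ
  have hcoh' : Order.coheight η' = 2 := coheight_eq_two_of_not_isClosed hcoh3' (hcodim' η' hsupp') hη'cl
  have hCeq : C = ⟨closure {η'}, isClosed_closure⟩ := Closeds.ext hη'
  have hY : C ∈ {D : Closeds X' | ∃ ζ ∈ maxPoints {z : X' | (μ : ℕ∞) ≤ idealOrder J' z},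
      ¬ IsClosed ({ζ} : Set X') ∧ D = ⟨closure {ζ}, isClosed_closure⟩} :=
    ⟨η', mem_maxPoints_setOf_of_coheight_eq_two hμ hcoh3' hcodim' (hCμ η' hη'C).ge hcoh', hη'cl, hCeq⟩
  have hRT'' := curveStep_noBad hX' hX3' J' hμ hJ'le hcodim' (𝒞 := {D : Closeds X' | _}) (fun _ => Iff.rfl) hRT' hY hτ
    (𝒞' := {D : Closeds (blowup (vanishingIdeal C)) | _}) (fun _ => Iff.rfl)
  exact ⟨X', hX'i, hX'n, σ, hσd, C, η', J', blowup (vanishingIdeal C), inferInstance, inferInstance, τ, inferInstance, hη', hση', hCreg, hCμ,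
    hJ'le, hseq, hτ, hcons, hle'', hRT', hRT''⟩

end Summit.ResolutionOfSingularities.ResolutionOfSingularities.Theorems.RadicialJung.CleanModels

end
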